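import Summits.Ventures.HodgeRepro2.T5RecordJointOutsideDiscriminant
import Summits.Ventures.HodgeRepro2.T5RationalPlace
import Summits.Ventures.HodgeRepro2.T5CyclotomicSevenInertPrime
import Summits.Ventures.HodgeRepro2.T5CyclotomicFourInertPrime

/-!
# Joint consistency at EVERY inert place of the two toy fields

Tier-5 support N3 / §G-N4.2 (seat p3, gen 87). File 356 states the joint instantiation of the lane's two capstones
(the lattice-model data of file 331 for `diag(1, 1, −1)` and the unramified spectrum of file 344, hypothesis-free per
file 355) for every CM field at every place `v` of `K⁺` with `disc K ∉ v` that stays prime. This file reads it at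
EVERY inert place of the two toy fields, with the place of `ℚ` below it supplied by file 357's `vRat p`:

* **`joint_seven_inert`** — the field of record `ℚ(ζ₇)` at every place `vPrime K p h6` above a prime `p` of order `6`
  modulo `7` (`p ≡ 3, 5 (mod 7)`; `N(v) = p³`): `disc ℚ(ζ₇) = −7⁵ ∉ v` because `p ∤ 7` (`seven_notMem_vPrime`);
* **`joint_four_inert`** — `ℚ(i)` at every place `vPrime L p h2` above a prime `p ≡ 3 (mod 4)` (`N(v) = p`):
  `disc ℚ(i) = −4 ∉ v` because `p ∤ 2` (`two_notMem_vPrime`).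

In each the `LiesOver` instance `v ∣ vRat p` is bound by `letI := liesOver_vRat_of_mem …` inside the statement and
passed explicitly in the proof (annex §96(c) / §98(d): instance binders under `∃` / `haveI` are the heartbeat sink,
explicit terms are not). Together with files 349 / 352 / 356: README §10.5 (ii)(d) holds at every inert place of
both toy fields. §8(d): uses an L-value-free non-vanishing device: NO.
-/

open Matrix NumberField NumberField.IsCMField IsDedekindDomain IsDedekindDomain.HeightOneSpectrum Module
  MulAction
open scoped TensorProduct Pointwise
open Summit.Ventures.HodgeRepro2.T5UnitaryGroupForm Summit.Ventures.HodgeRepro2.T5UnitaryHeckeAdjoint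
  Summit.Ventures.HodgeRepro2.T5HeckePermutationModule Summit.Ventures.HodgeRepro2.LevelPositivity
  Summit.Ventures.HodgeRepro2.T5LevelIdempotent Summit.Ventures.HodgeRepro2.T5StarOfInvolution
  Summit.Ventures.HodgeRepro2.T5FinitePlaceCM Summit.Ventures.HodgeRepro2.T5NonSplitPlaceUnitaryGroup
  Summit.Ventures.HodgeRepro2.T5RecordHyperspecial Summit.Ventures.HodgeRepro2.T5GlobalLatticeAlmostAll
  Summit.Ventures.HodgeRepro2.T5HermitianThreeElements Summit.Ventures.HodgeRepro2.T5GaloisCartanThree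
  Summit.Ventures.HodgeRepro2.T5InertDegreeGalois Summit.Ventures.HodgeRepro2.T5InertPlaceCompletion
  Summit.Ventures.HodgeRepro2.T5InertDegreeAdicCompletion Summit.Ventures.HodgeRepro2.T5InertSatakeTransform
  Summit.Ventures.HodgeRepro2.T5InertSatakeTransformCompletion Summit.Ventures.HodgeRepro2.T5InertUnipotentResidue
  Summit.Ventures.HodgeRepro2.T5InertSphericalSubquotient Summit.Ventures.HodgeRepro2.T5RecordSatakeCell
  Summit.Ventures.HodgeRepro2.T5SplitPlaceUnitaryGroup Summit.Ventures.HodgeRepro2.T5FinitePlaceNormIndex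
  Summit.Ventures.HodgeRepro2.T5HermitianLocalIsotropyN3 Summit.Ventures.HodgeRepro2.T5FinitePlaceSplitClassification
  Summit.Ventures.HodgeRepro2.T5InertDegreeCompletion Summit.Ventures.HodgeRepro2.T5InertPlaceCompletionCells
  Summit.Ventures.HodgeRepro2.T5RecordSatake Summit.Ventures.HodgeRepro2.T5CartanCellsDistinct
  Summit.Ventures.HodgeRepro2.T5RecordSatakeInert Summit.Ventures.HodgeRepro2.T5InertGlobalPrime
  Summit.Ventures.HodgeRepro2.T5CMFieldSquareDatum Summit.Ventures.HodgeRepro2.T5RecordSatakeDegree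
  Summit.Ventures.HodgeRepro2.T5RecordSatakeDegreeIntrinsic Summit.Ventures.HodgeRepro2.T5RecordSphericalSpectrum
  Summit.Ventures.HodgeRepro2.T5RecordSphericalSpectrumIntrinsic Summit.Ventures.HodgeRepro2.T5RecordSatakeToy
  Summit.Ventures.HodgeRepro2.T5RecordSphericalSpectrumDatumFree
  Summit.Ventures.HodgeRepro2.T5AdditiveConductor Summit.Ventures.HodgeRepro2.T5UnitaryGroupIsometry
  Summit.Ventures.HodgeRepro2.T5ConductorDualLattice Summit.Ventures.HodgeRepro2.T5ConductorDualLatticeSplit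
  Summit.Ventures.HodgeRepro2.T5SplitHermitianClass Summit.Ventures.HodgeRepro2.T5RecordLatticeModelOutsideDiscriminant
  Summit.Ventures.HodgeRepro2.T5RecordLatticeModelSeven Summit.Ventures.HodgeRepro2.T5RecordJointOutsideDiscriminant
  Summit.Ventures.HodgeRepro2.T5RationalPlace Summit.Ventures.HodgeRepro2.T5ConductorZeroCharacter

namespace Summit.Ventures.HodgeRepro2.T5RecordJointToyInertPlaces

universe uV

section Seven

open Summit.Ventures.HodgeRepro2.T5CyclotomicSevenInertPrime

variable (K : Type*) [Field K] [CharZero K] [IsCyclotomicExtension {7} ℚ K] [NumberField K] [IsCMField K]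
variable (p : ℕ) [hp : Fact p.Prime] (h6 : orderOf (p : ZMod 7) = 6)
variable (k : Type*) [Field k] [CharZero k] [IsAlgClosed k]

omit [NumberField K] [IsCMField K] in
/-- `7 ∉ vPrime K p h6`: the place contains `p`, and `p ∤ 7` (`not_dvd_seven_of_orderOf_eq_six`). -/
theorem seven_notMem_vPrime : (7 : 𝓞 (maximalRealSubfield K)) ∉ (vPrime K p h6).asIdeal := by
  have h := notMem_of_mem_of_prime_of_not_dvd (vPrime K p h6).asIdeal (vPrime K p h6).isPrime.ne_top hp.out
    (not_dvd_seven_of_orderOf_eq_six p h6) (natCast_mem_vPrime K p h6)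
  exact_mod_cast h

/-- **JOINT CONSISTENCY ON `ℚ(ζ₇)` AT EVERY INERT PLACE OF ORDER `6`** (file 356 at `vp = vRat p`, `v = vPrime K p h6`,
`w = wPrime K p h6`): the lattice-model data for `diag(1, 1, −1)` AND the unramified spectrum of the record's pair
with the Satake parameter `α · (p³)⁻²`, for every prime `p ≡ 3, 5 (mod 7)`. -/
theorem joint_seven_inert :
    letI : (vPrime K p h6).asIdeal.LiesOver (vRat p).asIdeal :=
      liesOver_vRat_of_mem p (vPrime K p h6) (natCast_mem_vPrime K p h6)
    ((∃ ψ : AddChar ((vRat p).adicCompletion ℚ) Circle, Continuous ψ ∧ (∃ y, ψ y ≠ 1) ∧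
      conductorExp ψ (Valued.v : Valuation ((vRat p).adicCompletion ℚ) (WithZero (Multiplicative ℤ))) = 0 ∧
      conductorExp (ψ.compAddMonoidHom
        (Algebra.trace ((vRat p).adicCompletion ℚ) ((vPrime K p h6).adicCompletion (maximalRealSubfield K))).toAddMonoidHom)
        (Valued.v : Valuation ((vPrime K p h6).adicCompletion (maximalRealSubfield K)) (WithZero (Multiplicative ℤ))) = 0) ∧
    ∀ (ψ : AddChar ((vRat p).adicCompletion ℚ) Circle), Continuous ψ → (∃ y, ψ y ≠ 1) →
      conductorExp ψ (Valued.v : Valuation ((vRat p).adicCompletion ℚ) (WithZero (Multiplicative ℤ))) = 0 →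
      ∀ (w' : HeightOneSpectrum (𝓞 K)) [w'.asIdeal.LiesOver (vPrime K p h6).asIdeal],
        (vPrime K p h6).asIdeal.ramificationIdx' w'.asIdeal = 1 ∧
        conductorExp (recordChar K (vRat p) (vPrime K p h6) w' ψ)
          (Valued.v : Valuation (w'.adicCompletion K) (WithZero (Multiplicative ℤ))) = 0 ∧
        (∀ x : w'.adicCompletion K,
          (∀ y : w'.adicCompletion K, Valued.v y ≤ 1 → recordChar K (vRat p) (vPrime K p h6) w' ψ (x * y) = 1) ↔ Valued.v x ≤ 1) ∧
        (∀ [StarRing (w'.adicCompletion K)],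
          (∀ z : w'.adicCompletion K, IsLocalization.IsInteger (w'.adicCompletionIntegers K) z →
            IsLocalization.IsInteger (w'.adicCompletionIntegers K) (star z)) →
          ∀ x : Fin 3 → w'.adicCompletion K,
            (∀ y ∈ stdLattice (w'.adicCompletionIntegers K),
              recordChar K (vRat p) (vPrime K p h6) w' ψ
                (sesqForm (((algebraMap (𝓞 K) K).mapMatrix (Matrix.diagonal ![1, 1, -1])).map (algebraMap K (w'.adicCompletion K))) x y) = 1) ↔
              x ∈ stdLattice (w'.adicCompletionIntegers K)) ∧
        (letI := swapStarRing (w'.adicCompletion K)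
          ∀ x : Fin 3 → w'.adicCompletion K × w'.adicCompletion K,
            (∀ y : Fin 3 → w'.adicCompletion K × w'.adicCompletion K,
              (∀ i, Valued.v (y i).1 ≤ 1 ∧ Valued.v (y i).2 ≤ 1) →
              recordChar K (vRat p) (vPrime K p h6) w' ψ
                  (sesqForm (pairMatrix (((algebraMap (𝓞 K) K).mapMatrix (Matrix.diagonal ![1, 1, -1])).map (algebraMap K (w'.adicCompletion K)))
                    (((algebraMap (𝓞 K) K).mapMatrix (Matrix.diagonal ![1, 1, -1])).map (algebraMap K (w'.adicCompletion K)))ᵀ) x y).1 *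
                recordChar K (vRat p) (vPrime K p h6) w' ψ
                  (sesqForm (pairMatrix (((algebraMap (𝓞 K) K).mapMatrix (Matrix.diagonal ![1, 1, -1])).map (algebraMap K (w'.adicCompletion K)))
                    (((algebraMap (𝓞 K) K).mapMatrix (Matrix.diagonal ![1, 1, -1])).map (algebraMap K (w'.adicCompletion K)))ᵀ) x y).2 = 1) ↔
              ∀ i, Valued.v (x i).1 ≤ 1 ∧ Valued.v (x i).2 ≤ 1)) ∧
    (∃ (θ : maximalRealSubfield K) (y : K) (hθ : algebraMap (maximalRealSubfield K) K θ = y ^ 2)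
      (hy : complexConj K y ≠ y) (r : ℕ) (l : Fin r → 𝓞 K)
      (_hl : Submodule.span (𝓞 (maximalRealSubfield K)) (Set.range l) = ⊤),
      letI := tensorStarRing K (vPrime K p h6)
      letI := starRingOfQuadratic (finrank_eq_two K (vPrime K p h6) (wPrime K p h6) hθ hy (not_isSquare_of_staysPrime K (vPrime K p h6) (wPrime K p h6) hθ hy (map_vPrime K p h6)))
        (localConj (vPrime K p h6) (wPrime K p h6) hθ.symm (span_pair_eq_top K hy) (not_isSquare_of_staysPrime K (vPrime K p h6) (wPrime K p h6) hθ hy (map_vPrime K p h6)) (complexConj K))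
        (localConj_ne_one (vPrime K p h6) (wPrime K p h6) hθ.symm (span_pair_eq_top K hy) (not_isSquare_of_staysPrime K (vPrime K p h6) (wPrime K p h6) hθ hy (map_vPrime K p h6))
          (complexConj K) (complexConj_apply_eq_neg K hθ hy))
      haveI := isDiscreteValuationRing_integralClosure_adicCompletion (vPrime K p h6) (wPrime K p h6)
      haveI := finite_residueField_integralClosure_adicCompletion (vPrime K p h6) (wPrime K p h6)
      haveI : IsFractionRing (integralClosure ((vPrime K p h6).adicCompletionIntegers (maximalRealSubfield K)) ((wPrime K p h6).adicCompletion K))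
        ((wPrime K p h6).adicCompletion K) :=
        integralClosure.isFractionRing_of_finite_extension ((vPrime K p h6).adicCompletion (maximalRealSubfield K))
          ((wPrime K p h6).adicCompletion K)
      ∃ (u₀ : ((vPrime K p h6).adicCompletionIntegers (maximalRealSubfield K))ˣ)
        (Φ : ↥(formUnitaryGroup (J3 (algebraMap ((vPrime K p h6).adicCompletionIntegers (maximalRealSubfield K))
          ((wPrime K p h6).adicCompletion K) (u₀ : (vPrime K p h6).adicCompletionIntegers (maximalRealSubfield K))))) ≃*
          ↥(formUnitaryGroup (tensorGram K (vPrime K p h6) (gramToy K))))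
        (ϖ' : integralClosure ((vPrime K p h6).adicCompletionIntegers (maximalRealSubfield K)) ((wPrime K p h6).adicCompletion K))
        (hϖ' : Irreducible ϖ')
        (hs' : star (algebraMap (integralClosure ((vPrime K p h6).adicCompletionIntegers (maximalRealSubfield K))
          ((wPrime K p h6).adicCompletion K)) ((wPrime K p h6).adicCompletion K) ϖ') =
            algebraMap (integralClosure ((vPrime K p h6).adicCompletionIntegers (maximalRealSubfield K)) ((wPrime K p h6).adicCompletion K))
              ((wPrime K p h6).adicCompletion K) ϖ'),
        (∀ g, g ∈ hyperspecialSubgroup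
            (integralClosure ((vPrime K p h6).adicCompletionIntegers (maximalRealSubfield K)) ((wPrime K p h6).adicCompletion K))
            (J3 (algebraMap ((vPrime K p h6).adicCompletionIntegers (maximalRealSubfield K)) ((wPrime K p h6).adicCompletion K)
              (u₀ : (vPrime K p h6).adicCompletionIntegers (maximalRealSubfield K)))) ↔ Φ g ∈ recordHyperspecial K (vPrime K p h6) l (gramToy K)) ∧
        ∀ {V : Type uV} [AddCommGroup V] [Module k V]
          (ρ : Representation k (↥(formUnitaryGroup (tensorGram K (vPrime K p h6) (gramToy K)))) V) [ρ.IsIrreducible],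
          KFinite ρ (recordHyperspecial K (vPrime K p h6) l (gramToy K)) →
          ∀ [FiniteDimensional k (invariants ρ (recordHyperspecial K (vPrime K p h6) l (gramToy K)))],
          invariants ρ (recordHyperspecial K (vPrime K p h6) l (gramToy K)) ≠ ⊥ →
          ∃ α : k, α ≠ 0 ∧ Nonempty (ρ.Equiv (comp Φ.symm
            (inertSphericalQuot
              (hstar_of_star_eq (localConj (vPrime K p h6) (wPrime K p h6) hθ.symm (span_pair_eq_top K hy)
                (not_isSquare_of_staysPrime K (vPrime K p h6) (wPrime K p h6) hθ hy (map_vPrime K p h6)) (complexConj K))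
                (fun x => by rw [star_p8_eq_star K (vPrime K p h6) (wPrime K p h6) hθ hy (not_isSquare_of_staysPrime K (vPrime K p h6) (wPrime K p h6) hθ hy (map_vPrime K p h6))]; rfl))
              (algebraMap ((vPrime K p h6).adicCompletionIntegers (maximalRealSubfield K)) ((wPrime K p h6).adicCompletion K)
                (u₀ : (vPrime K p h6).adicCompletionIntegers (maximalRealSubfield K)))
              (star_algebraMap_of_star_eq (localConj (vPrime K p h6) (wPrime K p h6) hθ.symm (span_pair_eq_top K hy)
                (not_isSquare_of_staysPrime K (vPrime K p h6) (wPrime K p h6) hθ hy (map_vPrime K p h6)) (complexConj K))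
                (fun x => by rw [star_p8_eq_star K (vPrime K p h6) (wPrime K p h6) hθ hy (not_isSquare_of_staysPrime K (vPrime K p h6) (wPrime K p h6) hθ hy (map_vPrime K p h6))]; rfl)
                (u₀ : (vPrime K p h6).adicCompletionIntegers (maximalRealSubfield K)))
              (algebraMap_unit_ne_zero (F := (vPrime K p h6).adicCompletion (maximalRealSubfield K)) u₀)
              (isInteger_algebraMap (u₀ : (vPrime K p h6).adicCompletionIntegers (maximalRealSubfield K)))
              (isInteger_algebraMap_unit_inv u₀) hϖ' hs' k (α * ((Ideal.absNorm (vPrime K p h6).asIdeal : k) ^ 2)⁻¹))))) :=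
  @joint_outside_discriminant_of_staysPrime K _ _ _ (vRat p) (vPrime K p h6)
    (liesOver_vRat_of_mem p (vPrime K p h6) (natCast_mem_vPrime K p h6))
    (discr_seven_notMem K (vPrime K p h6) (seven_notMem_vPrime K p h6)) (wPrime K p h6) (liesOver_vPrime K p h6)
    (map_vPrime K p h6) k _ _ _

end Seven

section Four

open Summit.Ventures.HodgeRepro2.T5CyclotomicFourInertPrime

variable (L : Type*) [Field L] [CharZero L] [IsCyclotomicExtension {2 ^ 2} ℚ L] [NumberField L] [IsCMField L]
variable (p : ℕ) [hp : Fact p.Prime] (h2 : orderOf (p : ZMod (2 ^ 2)) = 2)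
variable (k : Type*) [Field k] [CharZero k] [IsAlgClosed k]

omit [NumberField L] [IsCMField L] in
/-- `2 ∉ vPrime L p h2`: the place contains `p`, and `p ∤ 2` (from `p ∤ 4`, `not_dvd_four_of_orderOf_eq_two`). -/
theorem two_notMem_vPrime : (2 : 𝓞 (maximalRealSubfield L)) ∉ (vPrime L p h2).asIdeal := by
  have hnd : ¬ p ∣ 2 := fun h => not_dvd_four_of_orderOf_eq_two p h2 (h.trans (dvd_pow_self 2 two_ne_zero))
  have h := notMem_of_mem_of_prime_of_not_dvd (vPrime L p h2).asIdeal (vPrime L p h2).isPrime.ne_top hp.out hnd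
    (natCast_mem_vPrime L p h2)
  exact_mod_cast h

/-- **JOINT CONSISTENCY ON `ℚ(i)` AT EVERY INERT PLACE** (file 356 at `vp = vRat p`, `v = vPrime L p h2`,
`w = wPrime L p h2`): the lattice-model data for `diag(1, 1, −1)` AND the unramified spectrum of the record's pair
with the Satake parameter `α · p⁻²`, for every prime `p ≡ 3 (mod 4)`. -/
theorem joint_four_inert :
    letI : (vPrime L p h2).asIdeal.LiesOver (vRat p).asIdeal :=
      liesOver_vRat_of_mem p (vPrime L p h2) (natCast_mem_vPrime L p h2)
    ((∃ ψ : AddChar ((vRat p).adicCompletion ℚ) Circle, Continuous ψ ∧ (∃ y, ψ y ≠ 1) ∧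
      conductorExp ψ (Valued.v : Valuation ((vRat p).adicCompletion ℚ) (WithZero (Multiplicative ℤ))) = 0 ∧
      conductorExp (ψ.compAddMonoidHom
        (Algebra.trace ((vRat p).adicCompletion ℚ) ((vPrime L p h2).adicCompletion (maximalRealSubfield L))).toAddMonoidHom)
        (Valued.v : Valuation ((vPrime L p h2).adicCompletion (maximalRealSubfield L)) (WithZero (Multiplicative ℤ))) = 0) ∧
    ∀ (ψ : AddChar ((vRat p).adicCompletion ℚ) Circle), Continuous ψ → (∃ y, ψ y ≠ 1) →
      conductorExp ψ (Valued.v : Valuation ((vRat p).adicCompletion ℚ) (WithZero (Multiplicative ℤ))) = 0 →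
      ∀ (w' : HeightOneSpectrum (𝓞 L)) [w'.asIdeal.LiesOver (vPrime L p h2).asIdeal],
        (vPrime L p h2).asIdeal.ramificationIdx' w'.asIdeal = 1 ∧
        conductorExp (recordChar L (vRat p) (vPrime L p h2) w' ψ)
          (Valued.v : Valuation (w'.adicCompletion L) (WithZero (Multiplicative ℤ))) = 0 ∧
        (∀ x : w'.adicCompletion L,
          (∀ y : w'.adicCompletion L, Valued.v y ≤ 1 → recordChar L (vRat p) (vPrime L p h2) w' ψ (x * y) = 1) ↔ Valued.v x ≤ 1) ∧
        (∀ [StarRing (w'.adicCompletion L)],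
          (∀ z : w'.adicCompletion L, IsLocalization.IsInteger (w'.adicCompletionIntegers L) z →
            IsLocalization.IsInteger (w'.adicCompletionIntegers L) (star z)) →
          ∀ x : Fin 3 → w'.adicCompletion L,
            (∀ y ∈ stdLattice (w'.adicCompletionIntegers L),
              recordChar L (vRat p) (vPrime L p h2) w' ψ
                (sesqForm (((algebraMap (𝓞 L) L).mapMatrix (Matrix.diagonal ![1, 1, -1])).map (algebraMap L (w'.adicCompletion L))) x y) = 1) ↔
              x ∈ stdLattice (w'.adicCompletionIntegers L)) ∧
        (letI := swapStarRing (w'.adicCompletion L)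
          ∀ x : Fin 3 → w'.adicCompletion L × w'.adicCompletion L,
            (∀ y : Fin 3 → w'.adicCompletion L × w'.adicCompletion L,
              (∀ i, Valued.v (y i).1 ≤ 1 ∧ Valued.v (y i).2 ≤ 1) →
              recordChar L (vRat p) (vPrime L p h2) w' ψ
                  (sesqForm (pairMatrix (((algebraMap (𝓞 L) L).mapMatrix (Matrix.diagonal ![1, 1, -1])).map (algebraMap L (w'.adicCompletion L)))
                    (((algebraMap (𝓞 L) L).mapMatrix (Matrix.diagonal ![1, 1, -1])).map (algebraMap L (w'.adicCompletion L)))ᵀ) x y).1 *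
                recordChar L (vRat p) (vPrime L p h2) w' ψ
                  (sesqForm (pairMatrix (((algebraMap (𝓞 L) L).mapMatrix (Matrix.diagonal ![1, 1, -1])).map (algebraMap L (w'.adicCompletion L)))
                    (((algebraMap (𝓞 L) L).mapMatrix (Matrix.diagonal ![1, 1, -1])).map (algebraMap L (w'.adicCompletion L)))ᵀ) x y).2 = 1) ↔
              ∀ i, Valued.v (x i).1 ≤ 1 ∧ Valued.v (x i).2 ≤ 1)) ∧
    (∃ (θ : maximalRealSubfield L) (y : L) (hθ : algebraMap (maximalRealSubfield L) L θ = y ^ 2)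
      (hy : complexConj L y ≠ y) (r : ℕ) (l : Fin r → 𝓞 L)
      (_hl : Submodule.span (𝓞 (maximalRealSubfield L)) (Set.range l) = ⊤),
      letI := tensorStarRing L (vPrime L p h2)
      letI := starRingOfQuadratic (finrank_eq_two L (vPrime L p h2) (wPrime L p h2) hθ hy (not_isSquare_of_staysPrime L (vPrime L p h2) (wPrime L p h2) hθ hy (map_vPrime L p h2)))
        (localConj (vPrime L p h2) (wPrime L p h2) hθ.symm (span_pair_eq_top L hy) (not_isSquare_of_staysPrime L (vPrime L p h2) (wPrime L p h2) hθ hy (map_vPrime L p h2)) (complexConj L))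
        (localConj_ne_one (vPrime L p h2) (wPrime L p h2) hθ.symm (span_pair_eq_top L hy) (not_isSquare_of_staysPrime L (vPrime L p h2) (wPrime L p h2) hθ hy (map_vPrime L p h2))
          (complexConj L) (complexConj_apply_eq_neg L hθ hy))
      haveI := isDiscreteValuationRing_integralClosure_adicCompletion (vPrime L p h2) (wPrime L p h2)
      haveI := finite_residueField_integralClosure_adicCompletion (vPrime L p h2) (wPrime L p h2)
      haveI : IsFractionRing (integralClosure ((vPrime L p h2).adicCompletionIntegers (maximalRealSubfield L)) ((wPrime L p h2).adicCompletion L))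
        ((wPrime L p h2).adicCompletion L) :=
        integralClosure.isFractionRing_of_finite_extension ((vPrime L p h2).adicCompletion (maximalRealSubfield L))
          ((wPrime L p h2).adicCompletion L)
      ∃ (u₀ : ((vPrime L p h2).adicCompletionIntegers (maximalRealSubfield L))ˣ)
        (Φ : ↥(formUnitaryGroup (J3 (algebraMap ((vPrime L p h2).adicCompletionIntegers (maximalRealSubfield L))
          ((wPrime L p h2).adicCompletion L) (u₀ : (vPrime L p h2).adicCompletionIntegers (maximalRealSubfield L))))) ≃*
          ↥(formUnitaryGroup (tensorGram L (vPrime L p h2) (gramToy L))))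
        (ϖ' : integralClosure ((vPrime L p h2).adicCompletionIntegers (maximalRealSubfield L)) ((wPrime L p h2).adicCompletion L))
        (hϖ' : Irreducible ϖ')
        (hs' : star (algebraMap (integralClosure ((vPrime L p h2).adicCompletionIntegers (maximalRealSubfield L))
          ((wPrime L p h2).adicCompletion L)) ((wPrime L p h2).adicCompletion L) ϖ') =
            algebraMap (integralClosure ((vPrime L p h2).adicCompletionIntegers (maximalRealSubfield L)) ((wPrime L p h2).adicCompletion L))
              ((wPrime L p h2).adicCompletion L) ϖ'),
        (∀ g, g ∈ hyperspecialSubgroup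
            (integralClosure ((vPrime L p h2).adicCompletionIntegers (maximalRealSubfield L)) ((wPrime L p h2).adicCompletion L))
            (J3 (algebraMap ((vPrime L p h2).adicCompletionIntegers (maximalRealSubfield L)) ((wPrime L p h2).adicCompletion L)
              (u₀ : (vPrime L p h2).adicCompletionIntegers (maximalRealSubfield L)))) ↔ Φ g ∈ recordHyperspecial L (vPrime L p h2) l (gramToy L)) ∧
        ∀ {V : Type uV} [AddCommGroup V] [Module k V]
          (ρ : Representation k (↥(formUnitaryGroup (tensorGram L (vPrime L p h2) (gramToy L)))) V) [ρ.IsIrreducible],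
          KFinite ρ (recordHyperspecial L (vPrime L p h2) l (gramToy L)) →
          ∀ [FiniteDimensional k (invariants ρ (recordHyperspecial L (vPrime L p h2) l (gramToy L)))],
          invariants ρ (recordHyperspecial L (vPrime L p h2) l (gramToy L)) ≠ ⊥ →
          ∃ α : k, α ≠ 0 ∧ Nonempty (ρ.Equiv (comp Φ.symm
            (inertSphericalQuot
              (hstar_of_star_eq (localConj (vPrime L p h2) (wPrime L p h2) hθ.symm (span_pair_eq_top L hy)
                (not_isSquare_of_staysPrime L (vPrime L p h2) (wPrime L p h2) hθ hy (map_vPrime L p h2)) (complexConj L))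
                (fun x => by rw [star_p8_eq_star L (vPrime L p h2) (wPrime L p h2) hθ hy (not_isSquare_of_staysPrime L (vPrime L p h2) (wPrime L p h2) hθ hy (map_vPrime L p h2))]; rfl))
              (algebraMap ((vPrime L p h2).adicCompletionIntegers (maximalRealSubfield L)) ((wPrime L p h2).adicCompletion L)
                (u₀ : (vPrime L p h2).adicCompletionIntegers (maximalRealSubfield L)))
              (star_algebraMap_of_star_eq (localConj (vPrime L p h2) (wPrime L p h2) hθ.symm (span_pair_eq_top L hy)
                (not_isSquare_of_staysPrime L (vPrime L p h2) (wPrime L p h2) hθ hy (map_vPrime L p h2)) (complexConj L))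
                (fun x => by rw [star_p8_eq_star L (vPrime L p h2) (wPrime L p h2) hθ hy (not_isSquare_of_staysPrime L (vPrime L p h2) (wPrime L p h2) hθ hy (map_vPrime L p h2))]; rfl)
                (u₀ : (vPrime L p h2).adicCompletionIntegers (maximalRealSubfield L)))
              (algebraMap_unit_ne_zero (F := (vPrime L p h2).adicCompletion (maximalRealSubfield L)) u₀)
              (isInteger_algebraMap (u₀ : (vPrime L p h2).adicCompletionIntegers (maximalRealSubfield L)))
              (isInteger_algebraMap_unit_inv u₀) hϖ' hs' k (α * ((Ideal.absNorm (vPrime L p h2).asIdeal : k) ^ 2)⁻¹))))) :=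
  @joint_outside_discriminant_of_staysPrime L _ _ _ (vRat p) (vPrime L p h2)
    (liesOver_vRat_of_mem p (vPrime L p h2) (natCast_mem_vPrime L p h2))
    (discr_four_notMem L (vPrime L p h2) (two_notMem_vPrime L p h2)) (wPrime L p h2) (liesOver_vPrime L p h2)
    (map_vPrime L p h2) k _ _ _

end Four

end Summit.Ventures.HodgeRepro2.T5RecordJointToyInertPlaces
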